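import Summits.CriticalPhenomena.PercolationContinuityZ3.Theorems.PercNearOneGluingNoHeavyPcintMemUniformGenBounds
import Summits.CriticalPhenomena.PercolationContinuityZ3.Theorems.PercNearOneGluingNoHeavyPcintPolyCert
import HarnessLib

/-!
# CriticalPhenomena/PercolationContinuityZ3 — Theorems/PercNearOneGluingNoHeavyPcintMemUniformChunk.lean: CHUNKED, ENCODED row lists for large uniform memory certificates (base dimension 6) — `O(√n)` kernel access, decoders, and the bridge to the flat-list theory

Lane prim-pcint, STRUCTURE rule (prim-pcint-2 GEN 19: the fourth rung, memory `10`, needs the 6192-row class automaton of base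
dimension `6`; flat-list indexing at depth 6192 inside `decide` is quadratic and exhausts the kernel, cf. the lane's kernel lessons).
This file is bookkeeping only:

* `cget T i` — element `i` of a two-level list `T : List (List α)` with chunks of length `64` (`T[i/64][i%64]`), `ChunksOK`
  (every chunk but the last has length `64`, the last at most `64`; a `Bool`), and **`getElem?_flatten_eq_cget`**:
  `T.flatten[i]? = cget T i`;
* decoders of the compact row encoding used by the generated data files: a remembered pair `(r, j)` of `ℤ⁶ × ℕ` is the numeral
  `j + 16·Σ_i (r_i + 16)·32^i` (`decPair6`), a successor entry `(letter l, row t, symmetry c)` is `l + 12·(t + 8192·c)` (`decSucc6`,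
  letters `l = 2·axis + (0 ↔ positive)`, symmetries `sperm6 c = (perm6[c % 720], bit i of c/720 set ↔ coordinate i negated)`),
  `decRow6 : List ℕ × List ℕ → SCertRow 6`, `rowsOf T` (the flat decoded list the theory of …MemUniformGen(+Bounds) speaks about);
* chunked accessors `sstC`, `ssuccC`, `sistepC` with `sstOf (rowsOf T) i = sstC T i`, `ssucc (rowsOf T) i a = ssuccC T i a`;
* range-chunkable decidable checks and their bridges: `URowsOKC` ⇒ `UStructK 10`-type structure (`ustructK_of_chunks`), `USuppRowsC` ⇒
  `USuppK` (`usuppK_of_chunks`), numeral certificates with chunked weights `UNumRowsC` ⇒ `UNumOKK` (`unumOKK_of_chunks`), and the list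
  form of the `k = 5` row sums (`lettersSix`, `baseSum6_eq`, `freshSum6_eq`).

HONEST FRAMING: data-structure bookkeeping so that kernel checks of a 6192-row list stay linear.  No `sorry`; standard axioms.
Written by prim-pcint-2 gen 19 (prover-prim-pcint-2-g19-0), 2026-08-26.
-/

namespace Summit.CriticalPhenomena.PercolationContinuityZ3.Theorems.Pcint

open Literature.Probability.Percolation Literature.Probability.LatticeModels PolyCert

/-! ### Two-level lists -/

section Chunk

variable {α : Type*}

/-- Element `i` of a two-level list with chunks of length `64`. [folklore] -/
def cget (T : List (List α)) (i : ℕ) : Option α := (T[i / 64]?).bind fun c => c[i % 64]?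

/-- Chunk-length discipline: every chunk but the last has length `64`, the last at most `64`. [folklore] -/
def ChunksOK : List (List α) → Bool
  | [] => true
  | [c] => decide (c.length ≤ 64)
  | c :: c' :: T => decide (c.length = 64) && ChunksOK (c' :: T)

/-- **The bridge**: flat indexing of the flattened list is chunked indexing. [folklore] -/
theorem getElem?_flatten_eq_cget : ∀ (T : List (List α)), ChunksOK T = true → ∀ i : ℕ, T.flatten[i]? = cget T i
  | [], _, i => by simp [cget]
  | [c], h, i => by
    simp only [ChunksOK, decide_eq_true_eq] at h
    simp only [List.flatten_cons, List.flatten_nil, List.append_nil, cget]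
    by_cases hi : i < 64
    · simp [show i / 64 = 0 by omega, show i % 64 = i by omega]
    · rw [show ([c] : List (List α))[i / 64]? = none from List.getElem?_eq_none (by simp; omega)]
      simp only [Option.bind_none]
      exact List.getElem?_eq_none (by omega)
  | c :: c' :: T, h, i => by
    simp only [ChunksOK, Bool.and_eq_true, decide_eq_true_eq] at h
    obtain ⟨hc, hT⟩ := h
    rw [List.flatten_cons, List.getElem?_append]
    by_cases hi : i < 64
    · rw [if_pos (by omega)]
      simp [cget, show i / 64 = 0 by omega, show i % 64 = i by omega]
    · rw [if_neg (by omega), hc, getElem?_flatten_eq_cget (c' :: T) hT (i - 64)]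
      simp only [cget]
      rw [show i / 64 = (i - 64) / 64 + 1 by omega, show i % 64 = (i - 64) % 64 by omega, List.getElem?_cons_succ]

/-- `getD` through the bridge. [folklore] -/
theorem getD_flatten_eq_cget (T : List (List α)) (hT : ChunksOK T = true) (i : ℕ) (dflt : α) :
    T.flatten.getD i dflt = (cget T i).getD dflt := by
  rw [List.getD_eq_getElem?_getD, getElem?_flatten_eq_cget T hT]

end Chunk

/-! ### Decoders of the compact row encoding (base dimension 6) -/

section Decode

/-- Non-negative integer in constructor form (`zp n = n`); the generated data files write integers as `zp n` / `zn n`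
because plain negative numerals in long list literals make elaboration quadratic. [folklore] -/
def zp (n : ℕ) : ℤ := Int.ofNat n

/-- Negative integer in constructor form (`zn n = −(n+1)`). [folklore] -/
def zn (n : ℕ) : ℤ := Int.negSucc n

/-- Integer 6-tuples: a kernel-friendly model of the sites of `ℤ⁶` (componentwise decidable equality, no closures). [folklore] -/
abbrev T6 : Type := ℤ × ℤ × ℤ × ℤ × ℤ × ℤ

/-- The site of a 6-tuple. [folklore] -/
def tsite (t : T6) : Site 6 := ![t.1, t.2.1, t.2.2.1, t.2.2.2.1, t.2.2.2.2.1, t.2.2.2.2.2]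

/-- Component `j` of a 6-tuple (`0` beyond `5`). [folklore] -/
def tget (t : T6) (j : ℕ) : ℤ :=
  match j with
  | 0 => t.1 | 1 => t.2.1 | 2 => t.2.2.1 | 3 => t.2.2.2.1 | 4 => t.2.2.2.2.1 | 5 => t.2.2.2.2.2 | _ => 0

/-- A state (finite set of (site, age) pairs) from a list of (tuple, age) pairs. [folklore] -/
def ofListState (S : List (T6 × ℕ)) : MState 6 := (S.map fun q => (tsite q.1, q.2)).toFinset

/-- Coordinate `i` of an encoded site: digit `i` base `32` of `n / 16`, offset `16`. [folklore] -/
def decCoord (n i : ℕ) : ℤ := ((n / 16 / 32 ^ i % 32 : ℕ) : ℤ) - 16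

/-- The encoded site as a 6-tuple. [folklore] -/
def decT (n : ℕ) : T6 := (decCoord n 0, decCoord n 1, decCoord n 2, decCoord n 3, decCoord n 4, decCoord n 5)

/-- The encoded (tuple, age) pair (`age = n % 16`). [folklore] -/
def decPT (n : ℕ) : T6 × ℕ := (decT n, n % 16)

/-- The encoded site of `ℤ⁶`. [folklore] -/
def decSite6 (n : ℕ) : Site 6 := tsite (decT n)

/-- The encoded (site, age) pair. [folklore] -/
def decPair6 (n : ℕ) : Site 6 × ℕ := (decSite6 n, n % 16)

/-- The encoded state (a list of pair codes). [folklore] -/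
def decState6 (l : List ℕ) : MState 6 := ofListState (l.map decPT)

/-- Letter number `l < 12`: axis `l / 2`, positive iff `l` even. [folklore] -/
def decLetter6 (l : ℕ) : Fin 6 × Bool := (⟨l % 12 / 2, by omega⟩, l % 2 == 0)

/-- The transpositions-product form of a permutation of `Fin 6` given in one-line notation is assembled by the data file; here only the
lookup: signed permutation number `c` = (permutation `P[c % 720]`, sign bits of `c / 720`). [folklore] -/
def spermOf6 (P : List (Equiv.Perm (Fin 6))) (c : ℕ) : SPerm 6 :=
  (P.getD (c % 720) (Equiv.refl _), fun i => !(Nat.testBit (c / 720) i.1))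

/-- The encoded successor entry `l + 12·(t + 8192·c)`. [folklore] -/
def decSucc6 (P : List (Equiv.Perm (Fin 6))) (m : ℕ) : (Fin 6 × Bool) × ℕ × SPerm 6 :=
  (decLetter6 (m % 12), m / 12 % 8192, spermOf6 P (m / 98304))

/-- The encoded row (state codes, successor codes); weight field unused (`1`). [folklore] -/
def decRow6 (P : List (Equiv.Perm (Fin 6))) (r : List ℕ × List ℕ) : SCertRow 6 :=
  ⟨decState6 r.1, 1, r.2.map (decSucc6 P)⟩

/-- **The flat decoded row list** of a chunked code table (the object of …MemUniformGen / …GenBounds). [folklore] -/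
def rowsOf (P : List (Equiv.Perm (Fin 6))) (T : List (List (List ℕ × List ℕ))) : List (SCertRow 6) :=
  T.flatten.map (decRow6 P)

variable (P : List (Equiv.Perm (Fin 6))) (T : List (List (List ℕ × List ℕ)))

/-- Chunked state accessor. [folklore] -/
def sstC (i : ℕ) : MState 6 :=
  match cget T i with
  | some r => decState6 r.1
  | none => ∅

/-- Chunked successor accessor. [folklore] -/
def ssuccC (i : ℕ) (a : Fin 6 × Bool) : Option (ℕ × SPerm 6) :=
  match cget T i with
  | some r => ((r.2.map (decSucc6 P)).find? fun q => q.1 = a).map fun q => q.2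
  | none => none

/-- Chunked index-automaton accessor. [folklore] -/
def sistepC (i : ℕ) (a : Fin 6 × Bool) : Option ℕ := (ssuccC P T i a).map fun p => p.1

/-- Length of the decoded list. [folklore] -/
theorem length_rowsOf : (rowsOf P T).length = (T.map List.length).sum := by
  rw [rowsOf, List.length_map, List.length_flatten]

/-- Flat indexing of the decoded list through the bridge. [folklore] -/
theorem getElem?_rowsOf (hT : ChunksOK T = true) (i : ℕ) : (rowsOf P T)[i]? = (cget T i).map (decRow6 P) := by
  rw [rowsOf, List.getElem?_map, getElem?_flatten_eq_cget T hT]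

/-- `sstOf (rowsOf T) = sstC T`. [folklore] -/
theorem sstOf_rowsOf (hT : ChunksOK T = true) (i : ℕ) : sstOf (rowsOf P T) i = sstC T i := by
  unfold sstOf sstC
  rw [getElem?_rowsOf P T hT i]
  cases cget T i <;> rfl

/-- `ssucc (rowsOf T) = ssuccC T`. [folklore] -/
theorem ssucc_rowsOf (hT : ChunksOK T = true) (i : ℕ) (a : Fin 6 × Bool) : ssucc (rowsOf P T) i a = ssuccC P T i a := by
  unfold ssucc ssuccC
  rw [getElem?_rowsOf P T hT i]
  cases cget T i <;> rfl

/-- `sistep (rowsOf T) = sistepC T`. [folklore] -/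
theorem sistep_rowsOf (hT : ChunksOK T = true) (i : ℕ) (a : Fin 6 × Bool) : sistep (rowsOf P T) i a = sistepC P T i a := by
  unfold sistep sistepC; rw [ssucc_rowsOf P T hT]

end Decode

/-! ### Range-chunkable checks and their bridges -/

section Checks

variable (P : List (Equiv.Perm (Fin 6))) (T : List (List (List ℕ × List ℕ)))

/-- Structural check of one row against the chunked table (`N` = total number of rows). [folklore] -/
def URowOKC (τ N i : ℕ) : Prop :=
  ∀ a : Fin 6 × Bool,
    mstep τ (sstC T i) a = (ssuccC P T i a).map (fun p => smulState p.2 (sstC T p.1)) ∧ ∀ p ∈ ssuccC P T i a, p.1 < N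

/-- `URowOKC` is decidable. [folklore] -/
instance (τ N i : ℕ) : Decidable (URowOKC P T τ N i) := by
  unfold URowOKC; infer_instance

/-- Structural check of the rows `lo ≤ i < hi`. [folklore] -/
def URowsOKC (τ N lo hi : ℕ) : Prop := ∀ i < hi, lo ≤ i → URowOKC P T τ N i

/-- `URowsOKC` is decidable. [folklore] -/
instance (τ N lo hi : ℕ) : Decidable (URowsOKC P T τ N lo hi) := by
  unfold URowsOKC; infer_instance

/-- Ranges of row checks concatenate. [folklore] -/
theorem urowsOKC_append {τ N lo mid hi : ℕ} (h1 : URowsOKC P T τ N lo mid) (h2 : URowsOKC P T τ N mid hi) :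
    URowsOKC P T τ N lo hi := fun i hi' hlo =>
  if him : i < mid then h1 i him hlo else h2 i hi' (Nat.le_of_not_lt him)

/-- A full range gives every row. [folklore] -/
theorem urowOKC_of_range {τ N : ℕ} (h : URowsOKC P T τ N 0 N) : ∀ i < N, URowOKC P T τ N i := fun i hi => h i hi (Nat.zero_le i)

/-- **Structure from chunked row checks**: if every row `i < N` passes, `rowsOf T` (of length `N > 0`, row `0` empty) is
structurally valid. [folklore] -/
theorem ustructK_of_chunks {τ N : ℕ} (hT : ChunksOK T = true) (hN : (rowsOf P T).length = N) (hpos : 0 < N)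
    (h0 : sstC T 0 = ∅) (h : ∀ i < N, URowOKC P T τ N i) : UStructK (k := 5) τ (rowsOf P T) := by
  refine ⟨by omega, by rw [sstOf_rowsOf P T hT]; exact h0, fun i hi a => ?_⟩
  rw [hN] at hi ⊢
  obtain ⟨h1, h2⟩ := h i hi a
  rw [sstOf_rowsOf P T hT, ssucc_rowsOf P T hT, h1]
  refine ⟨?_, h2⟩
  congr 1
  funext p
  rw [sstOf_rowsOf P T hT]

/-- Support check of the rows `lo ≤ i < hi`: every remembered site vanishes on axis `5`. [folklore] -/
def USuppRowsC (lo hi : ℕ) : Prop := ∀ i < hi, lo ≤ i → ∀ q ∈ sstC T i, q.1 (Fin.last 5) = 0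

/-- `USuppRowsC` is decidable. [folklore] -/
instance (lo hi : ℕ) : Decidable (USuppRowsC T lo hi) := by
  unfold USuppRowsC; infer_instance

/-- Ranges of support checks concatenate. [folklore] -/
theorem usuppRowsC_append {lo mid hi : ℕ} (h1 : USuppRowsC T lo mid) (h2 : USuppRowsC T mid hi) : USuppRowsC T lo hi :=
  fun i hi' hlo => if him : i < mid then h1 i him hlo else h2 i hi' (Nat.le_of_not_lt him)

/-- **Support from chunked checks.** [folklore] -/
theorem usuppK_of_chunks {N : ℕ} (hT : ChunksOK T = true) (hN : (rowsOf P T).length = N)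
    (h : USuppRowsC T 0 N) : USuppK (k := 5) (rowsOf P T) := by
  intro i hi q hq
  rw [hN] at hi
  rw [sstOf_rowsOf P T hT] at hq
  exact h i hi (Nat.zero_le i) q hq

/-! #### Row sums for `k = 5` as list sums -/

/-- The twelve letters of `ℤ⁶` in the fixed order `(0,+), (0,−), …, (5,−)`. [folklore] -/
def lettersSix : List (Fin 6 × Bool) :=
  [(0, true), (0, false), (1, true), (1, false), (2, true), (2, false), (3, true), (3, false), (4, true), (4, false),
    (5, true), (5, false)]

/-- The base sum (`k = 5`) as a list sum over the twelve letters. [folklore] -/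
theorem baseSum6_eq (L : List (SCertRow 6)) (w : ℕ → ℝ) (i : ℕ) :
    baseSumK (k := 5) L w i = ((lettersSix.map (sistep L i)).map (optValR w)).sum := by
  simp only [baseSumK, Fintype.sum_prod_type, Fintype.sum_bool, Fin.sum_univ_def]
  rw [show List.finRange (5 + 1) = [0, 1, 2, 3, 4, 5] from rfl]
  simp only [List.map, List.sum_cons, List.sum_nil, lettersSix]
  ring

/-- The fresh sum (`k = 5`) as a list sum over the two letters of axis `5`. [folklore] -/
theorem freshSum6_eq (L : List (SCertRow 6)) (w : ℕ → ℝ) (i : ℕ) :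
    freshSumK (k := 5) L w i = (([((5 : Fin 6), true), ((5 : Fin 6), false)].map (sistep L i)).map (optValR w)).sum := by
  simp only [freshSumK, Fintype.sum_bool, List.map, List.sum_cons, List.sum_nil, add_zero,
    show (Fin.last 5 : Fin 6) = 5 from rfl]

/-! #### Numeral certificates with chunked weights -/

/-- Chunked natural-number weight accessor (default `0`). [folklore] -/
def vgetC (VT : List (List ℕ)) (j : ℕ) : ℕ := (cget VT j).getD 0

/-- Base part of a row sum with chunked weights, read from the chunked row table. [folklore] -/
def baseSumNC (VT : List (List ℕ)) (i : ℕ) : ℕ := ∑ a : Fin 6 × Bool, optVal (vgetC VT) (sistepC P T i a)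

/-- Fresh part of a row sum with chunked weights. [folklore] -/
def freshSumNC (VT : List (List ℕ)) (i : ℕ) : ℕ := ∑ b : Bool, optVal (vgetC VT) (sistepC P T i ((5 : Fin 6), b))

/-- Numeral certificate check of the rows `lo ≤ i < hi` in dimension `d ≥ 6`. [folklore] -/
def UNumRowsC (VT : List (List ℕ)) (d numHi numLo den lo hi : ℕ) : Prop :=
  ∀ i < hi, lo ≤ i → 0 < vgetC VT i ∧
    den * (baseSumNC P T VT i + (d - 6) * freshSumNC P T VT i) ≤ numHi * vgetC VT i ∧
      numLo * vgetC VT i ≤ den * (baseSumNC P T VT i + (d - 6) * freshSumNC P T VT i)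

/-- `UNumRowsC` is decidable. [folklore] -/
instance (VT : List (List ℕ)) (d numHi numLo den lo hi : ℕ) : Decidable (UNumRowsC P T VT d numHi numLo den lo hi) := by
  unfold UNumRowsC; infer_instance

/-- The numeral check of the rows `lo … lo+cnt−1` as a `Bool` (iterates only over the range). [folklore] -/
def UNumRowsB (VT : List (List ℕ)) (d numHi numLo den lo cnt : ℕ) : Bool :=
  (List.range' lo cnt).all fun i => decide (0 < vgetC VT i ∧
    den * (baseSumNC P T VT i + (d - 6) * freshSumNC P T VT i) ≤ numHi * vgetC VT i ∧
      numLo * vgetC VT i ≤ den * (baseSumNC P T VT i + (d - 6) * freshSumNC P T VT i))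

/-- Soundness of the `Bool` range form. [folklore] -/
theorem unumRowsC_of_B {VT : List (List ℕ)} {d numHi numLo den lo cnt : ℕ}
    (h : UNumRowsB P T VT d numHi numLo den lo cnt = true) : UNumRowsC P T VT d numHi numLo den lo (lo + cnt) := by
  intro i hi hlo
  have := List.all_eq_true.1 h i (List.mem_range'_1.2 ⟨hlo, hi⟩)
  simpa using this

/-- Ranges of numeral checks concatenate. [folklore] -/
theorem unumRowsC_append {VT : List (List ℕ)} {d numHi numLo den lo mid hi : ℕ}
    (h1 : UNumRowsC P T VT d numHi numLo den lo mid) (h2 : UNumRowsC P T VT d numHi numLo den mid hi) :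
    UNumRowsC P T VT d numHi numLo den lo hi :=
  fun i hi' hlo => if him : i < mid then h1 i him hlo else h2 i hi' (Nat.le_of_not_lt him)

/-- **Numeral certificate from chunked checks**: the flat statement `UNumOKK (rowsOf T) d numHi numLo den VT.flatten`. [folklore] -/
theorem unumOKK_of_chunks {N : ℕ} (hT : ChunksOK T = true) (hN : (rowsOf P T).length = N) {VT : List (List ℕ)}
    (hV : ChunksOK VT = true) {d numHi numLo den : ℕ} (h : UNumRowsC P T VT d numHi numLo den 0 N) :
    UNumOKK (k := 5) (rowsOf P T) d numHi numLo den VT.flatten := by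
  have hv : ∀ j, VT.flatten.getD j 0 = vgetC VT j := fun j => getD_flatten_eq_cget VT hV j 0
  have hvf : (fun j => VT.flatten.getD j 0) = vgetC VT := funext hv
  intro i hi
  rw [hN] at hi
  obtain ⟨h1, h2, h3⟩ := h i hi (Nat.zero_le i)
  have hb : baseSumNK (k := 5) (rowsOf P T) VT.flatten i = baseSumNC P T VT i := by
    unfold baseSumNK baseSumNC
    rw [hvf]
    exact Finset.sum_congr rfl fun a _ => by rw [sistep_rowsOf P T hT]
  have hf : freshSumNK (k := 5) (rowsOf P T) VT.flatten i = freshSumNC P T VT i := by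
    unfold freshSumNK freshSumNC
    rw [hvf, show (Fin.last 5 : Fin 6) = 5 from rfl]
    exact Finset.sum_congr rfl fun b _ => by rw [sistep_rowsOf P T hT]
  rw [hv i, hb, hf]
  exact ⟨h1, h2, h3⟩

end Checks

end Summit.CriticalPhenomena.PercolationContinuityZ3.Theorems.Pcint
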